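import Summits.Ventures.PercRepro.C026GluingMinor
import Summits.Ventures.PercRepro.C026ProdCFGluing

/-!
# THEOREM PROD-CF at every `p`: (CF) at `p = ½` on the marked minors gives C-026 at every `p` (p5, gen 16)

mine-3's Corollary 4 (`proofs/MINE3-PRODUCT.md` §2b): through the cell's antipodal principle
(typer-2's `quadForm_nonneg_of_minors`), C-026 at EVERY edge weight `p` for a marked multigraph `G`
follows from `0 ≤ Δ_CF` at `p = ½` on every marked minor of `G`; and for a 3-terminal gluing, from
`0 ≤ Δ_CF` on the two PARTS of every marked minor (`slackCF_gluing_nonneg` on the minor, which is a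
gluing by p6's `isGluing_minor`). The bridge between the class sum of `kernel26` (the residual form
`#BotM ≤ #ac|b + #bc|a` of `C026PassM`) and `Δ_CF` is Lemma Φ once more: `#BotM = #N²`.

* `card_botM_eq_card_nTwo` — `#BotM = #N²` (`kSwap c` / `kSwapInv c`);
* **`cubeSumQuad_kernel26_nonneg_iff_slackCF`** — `0 ≤ cubeSumQuad ![a, b, c] kernel26 ↔ 0 ≤ Δ_CF`:
  mine-3's «the class sum of C-026 is `Δ_CF`»;
* **`c026_of_slackCF_minors`** — the per-graph bridge: `0 ≤ Δ_CF` on every marked minor gives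
  C-026 at every `p` (p6's `c026_of_dFree_minors` with (CF) in place of the stronger D-free
  inequality);
* **`c026_of_gluing_slackCF_minors`** — the same for a gluing from `0 ≤ Δ_CF` on the two parts of
  every marked minor (THEOREM PROD-CF at every `p`).
-/

namespace PercRepro

open Finset

namespace MultiGraph

section ProdCFEveryP

variable {V E : Type*} {G : MultiGraph V E} [Fintype E] [DecidableEq E]

open Classical in
/-- **`#BotM = #N²`**: the open-cluster flip `kSwap c` carries `BotM = {IsBot, a ~ b in δ(S)}` onto
`N²`, the closed-cluster flip `kSwapInv c` back (Lemma Φ). -/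
theorem card_botM_eq_card_nTwo (a b c : V) :
    (univ.filter fun ω : Config E => G.BotM ω a b c).card =
      (univ.filter fun ω : Config E => G.NTwo ω a b c).card := by
  refine Finset.card_nbij' (G.kSwap c) (G.kSwapInv c) ?_ ?_ ?_ ?_
  · intro τ hτ
    simp only [Finset.coe_filter, Finset.mem_univ, true_and, Set.mem_setOf_eq] at hτ ⊢
    obtain ⟨⟨hab, hac, hbc⟩, hconn⟩ := hτ
    refine ⟨hconn, ?_, ?_, ?_⟩
    · rw [G.conn_compl_kSwap_iff]
      exact fun h => hac h.symm
    · rw [G.conn_compl_kSwap_iff]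
      exact fun h => hbc h.symm
    · intro h
      have h' := conn_kSwapInv_of_connAvoid h
      rw [kSwapInv_kSwap] at h'
      exact hab h'
  · intro ω hω
    simp only [Finset.coe_filter, Finset.mem_univ, true_and, Set.mem_setOf_eq] at hω ⊢
    obtain ⟨hab, hca, hcb, hav⟩ := hω
    have hca' : ¬ G.Conn (G.kSwapInv c ω) c a := by
      rw [conn_kSwapInv_iff]
      exact hca
    have hcb' : ¬ G.Conn (G.kSwapInv c ω) c b := by
      rw [conn_kSwapInv_iff]
      exact hcb
    refine ⟨⟨fun h => ?_, fun h => hca' h.symm, fun h => hcb' h.symm⟩, ?_⟩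
    · have h' := connAvoid_kSwap_of_conn hca' h
      rw [kSwap_kSwapInv] at h'
      exact hav h'
    · rw [kSwap_kSwapInv]
      exact hab
  · intro τ _
    exact kSwapInv_kSwap c τ
  · intro ω _
    exact kSwap_kSwapInv c ω

open Classical in
/-- **The class sum of `kernel26` is `Δ_CF`** (in sign): `0 ≤ cubeSumQuad ![a, b, c] kernel26` iff
`0 ≤ Δ_CF` — mine-3's «CFslack(G) = Δ_CF(G)», the C-026 reading of the antipodal principle. -/
theorem cubeSumQuad_kernel26_nonneg_iff_slackCF (a b c : V) :
    0 ≤ G.cubeSumQuad ![a, b, c] kernel26 ↔ 0 ≤ G.slackCF a b c := by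
  rw [G.cubeSumQuad_kernel26_nonneg_iff_M, card_botM_eq_card_nTwo]
  -- `slackCF_eq` is stated with the classical `DecidableEq E`; re-read it with the instance at hand
  have key : G.slackCF a b c =
      ((univ.filter fun ω : Config E => G.Conn ω c a ∧ ¬ G.Conn ω c b).card : ℤ) +
        ((univ.filter fun ω : Config E => G.Conn ω c b ∧ ¬ G.Conn ω c a).card : ℤ) -
        ((univ.filter fun ω : Config E => G.NTwo ω a b c).card : ℤ) := by
    convert slackCF_eq (G := G) a b c using 4
    repeat first | rfl | exact Subsingleton.elim _ _ | congr 1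
  rw [key]
  have e1 : (univ.filter fun ω : Config E => G.Conn ω a c ∧ ¬ G.Conn ω a b) =
      univ.filter fun ω : Config E => G.Conn ω c a ∧ ¬ G.Conn ω c b := by
    refine Finset.filter_congr fun ω _ => ?_
    constructor
    · rintro ⟨hac, hab⟩
      exact ⟨hac.symm, fun h => hab (hac.trans h)⟩
    · rintro ⟨hca, hcb⟩
      exact ⟨hca.symm, fun h => hcb (hca.trans h)⟩
  have e2 : (univ.filter fun ω : Config E => G.Conn ω b c ∧ ¬ G.Conn ω a b) =
      univ.filter fun ω : Config E => G.Conn ω c b ∧ ¬ G.Conn ω c a := by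
    refine Finset.filter_congr fun ω _ => ?_
    constructor
    · rintro ⟨hbc, hab⟩
      exact ⟨hbc.symm, fun h => hab (h.symm.trans hbc.symm)⟩
    · rintro ⟨hcb, hca⟩
      exact ⟨hcb.symm, fun h => hca (hcb.trans h.symm)⟩
  rw [e1, e2]
  constructor
  · intro h
    zify at h
    linarith
  · intro h
    zify
    linarith

/-- **THEOREM PROD-CF at every `p`, the per-graph bridge** (mine-3's Corollary 4, (ii) ⟹ (i)):
`0 ≤ Δ_CF` at `p = ½` on every marked minor of `G` gives C-026 at every edge weight `p`
(`(x + y₁)(y₁ + z) ≤ y₁ + y₂ + y₃` in the law-`3` coordinates) — p6's `c026_of_dFree_minors` with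
(CF) in place of the D-free inequality. -/
theorem c026_of_slackCF_minors (G : MultiGraph V E) (a b c : V)
    (h : ∀ u v : Config E, v ≤ u →
      0 ≤ (G.minor u v).slackCF (G.sureClass v a) (G.sureClass v b) (G.sureClass v c))
    (p : E → ℝ) (hp : IsProb p) :
    (G.law3 p a b c 0 + G.law3 p a b c 1) * (G.law3 p a b c 1 + G.law3 p a b c 4) ≤
      G.law3 p a b c 1 + G.law3 p a b c 2 + G.law3 p a b c 3 := by
  have h' := G.quadForm_nonneg_of_minors hp ![a, b, c] kernel26 fun u v huv => by
    rw [sureClass_vec]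
    exact (cubeSumQuad_kernel26_nonneg_iff_slackCF (G := G.minor u v) (G.sureClass v a)
      (G.sureClass v b) (G.sureClass v c)).mpr (h u v huv)
  rw [G.quadForm_kernel26] at h'
  linarith

/-- **THEOREM PROD-CF at every `p` on a gluing** (mine-3's Corollary 4 with Corollary 3): for a
3-terminal gluing, `0 ≤ Δ_CF` at `p = ½` on the two parts of every marked minor gives C-026 at
every edge weight `p` — every marked minor of a gluing is a gluing (p6's `isGluing_minor`), and
(CF) composes over it (`slackCF_gluing_nonneg`). -/
theorem c026_of_gluing_slackCF_minors (G : MultiGraph V E) (a b c : V) (side : E → Bool)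
    (hg : G.IsGluing a b c side)
    (h : ∀ u v : Config E, v ≤ u →
      0 ≤ ((G.minor u v).part (fun e => side e.1) true).slackCF
          (G.sureClass v a) (G.sureClass v b) (G.sureClass v c) ∧
        0 ≤ ((G.minor u v).part (fun e => side e.1) false).slackCF
          (G.sureClass v a) (G.sureClass v b) (G.sureClass v c))
    (p : E → ℝ) (hp : IsProb p) :
    (G.law3 p a b c 0 + G.law3 p a b c 1) * (G.law3 p a b c 1 + G.law3 p a b c 4) ≤
      G.law3 p a b c 1 + G.law3 p a b c 2 + G.law3 p a b c 3 :=
  c026_of_slackCF_minors G a b c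
    (fun u v huv => slackCF_gluing_nonneg (isGluing_minor hg u v) (h u v huv).1 (h u v huv).2) p hp

end ProdCFEveryP

end MultiGraph

end PercRepro
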